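import Summits.MatrixMultiplication.MatrixMultiplication.Theorems.AbelianSTPPCensusShapeCertVQBudgets
import Summits.MatrixMultiplication.MatrixMultiplication.Theorems.AbelianSTPPCensusShapeCertVPSpec

/-!
# Abelian STPP census — soundness of `ShapeCertVQ` (part 4a: what the node quantities certify)

Cell mm-stpp, rung F-M1; successor kernel item VQ-CERT in support of the closed crux item stmt-MatrixMultiplication-19191; seat
mm-stpp-vp-p2 (gen 1).  Verbatim after theory g6's `…ShapeCertVPSpec` with the level floor `loLev = 11` in place of `27`, the
search range `[loLev, hiLev)` of the break-level binary search, and the regenerated tables: small numeric facts (the clamped tables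
dominate level `loLev`; the top-level constant `low_numQ`), the checker's prefix quantities as multiset sums, and what the node
selections certify (`clAnyQ_spec`, `gnodeQ_spec`, `breakLevQ_spec`).  Data-independent facts (`three_le_tOf`, `budT_some`,
`tailEmpty_spec`, `budsOf_nil`, `budsOf_get`) are theory's, reused as is.
-/

set_option linter.dupNamespace false -- `MatrixMultiplication.MatrixMultiplication` (summit = problem, D-0017)
set_option autoImplicit false

namespace Summit.MatrixMultiplication.MatrixMultiplication.Theorems.ShapeCertVQ

open ShapeCert ShapeCertVP Multiset

section numerics
/-! ### Small numeric facts -/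

/-- the top-level inequality, order by order: the floor row of the ratio table (zero) times `2.25·M` stays below `10⁶·M·K` -/
theorem low_numQ : ∀ M ≤ 489, (tabRQ loLev).get 7 * ((3 * M + 3 * (M / 2)) / 2) ≤ M * D * K := by decide +kernel

/-- levels below the floor read the floor row of the ratio table -/
theorem tabRQ_ge_lo (L k : ℕ) : (tabRQ loLev).get k ≤ (tabRQ L).get k := by
  rcases Nat.lt_or_ge L loLev with h | h
  · have : tabRQ L = tabRQ loLev := by
      unfold tabRQ loLev at *; rw [if_pos (by omega), if_pos (by omega), if_pos h]; rfl
    rw [this]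
  · exact tabRQ_mono h k

/-- levels below the floor read the floor row of the Grynkiewicz table -/
theorem tabGQ_ge_lo (L i : ℕ) : (tabGQ loLev).get i ≤ (tabGQ L).get i := by
  rcases Nat.lt_or_ge L loLev with h | h
  · have : tabGQ L = tabGQ loLev := by
      unfold tabGQ loLev at *; rw [if_pos (by omega), if_pos (by omega), if_pos h]; rfl
    rw [this]
  · exact tabGQ_mono h i

/-- the ratio table at level `L` dominates every shape of level `≤ L` or `≤ loLev` -/
theorem rhoTQ_le_tabRQ' {M : ℕ} {x : ℕ × ℕ × ℕ} (hM : M ≤ 489) (hx : InUniv M x) {L : ℕ}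
    (hL : levTQ x ≤ loLev ∨ levTQ x ≤ L) {k : ℕ} (hk : capOK k (vol x) = true) : rhoTQ x ≤ (tabRQ L).get k := by
  rcases hL with hL | hL
  · exact (rhoTQ_le_tabRQ hM hx hL hk).trans (tabRQ_ge_lo L k)
  · exact rhoTQ_le_tabRQ hM hx hL hk

/-- the Grynkiewicz table at level `L` dominates every shape of level `≤ L` or `≤ loLev` -/
theorem qhTQ_le_tabGQ' {M : ℕ} {x : ℕ × ℕ × ℕ} (hM : M ≤ 489) (hx : InUniv M x) {L : ℕ}
    (hL : levTQ x ≤ loLev ∨ levTQ x ≤ L) (i : ℕ) : qhTQ x (tOf i) ≤ (tabGQ L).get i := by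
  rcases hL with hL | hL
  · exact (qhTQ_le_tabGQ hM hx hL i).trans (tabGQ_ge_lo L i)
  · exact qhTQ_le_tabGQ hM hx hL i

/-- the scaled ratio dominates gain over packing weight: `g·K ≤ rho·uu` -/
theorem gTQ_mul_le_rho {M : ℕ} {x : ℕ × ℕ × ℕ} (hU : InUniv M x) : gTQ x * K ≤ rhoTQ x * uu x := by
  unfold rhoTQ; rw [Nat.add_mul, Nat.one_mul]
  exact (Nat.lt_div_mul_add hU.uu_pos).le

/-- the scaled Grynkiewicz ratio dominates gain over weight: `g·K ≤ qh_t·ŵ_t` (positive weight) -/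
theorem gTQ_mul_le_qh {x : ℕ × ℕ × ℕ} {t : ℕ} (hw : 0 < whT x t) : gTQ x * K ≤ qhTQ x t * whT x t := by
  unfold qhTQ; rw [Nat.add_mul, Nat.one_mul]
  exact (Nat.lt_div_mul_add hw).le

end numerics

section translation
/-! ### The checker's prefix quantities as multiset sums -/

variable {M : ℕ} {fam : List Sh}

/-- `P₁` of the aggregates -/
theorem P1Of_eqQ (hw : WfQ M fam) (r : ℕ) : P1Of r (aggOf M fam) = ((famT fam).map (p1T r)).sum := by
  match r with
  | 0 => exact sab_eqQ hw
  | 1 => exact sca_eqQ hw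
  | r + 2 => exact sbc_eqQ hw

/-- `P₂` of the aggregates -/
theorem P2Of_eqQ (hw : WfQ M fam) (r : ℕ) : P2Of r (aggOf M fam) = ((famT fam).map (p2T r)).sum := by
  match r with
  | 0 => exact sbc_eqQ hw
  | 1 => exact sab_eqQ hw
  | r + 2 => exact sca_eqQ hw

/-- the fibre sum of a prefix -/
theorem fibL_eqQ (hw : WfQ M fam) (r t : ℕ) : fibL r t fam = ((famT fam).map (fibT r t)).sum :=
  agg_sum_eqQ hw _ _ fun x => by simp [fibT]

/-- the credit sum of a prefix -/
theorem crS_eqQ (hw : WfQ M fam) (r t : ℕ) : crS r t fam = ((famT fam).map (crT r t)).sum :=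
  agg_sum_eqQ hw _ _ fun x => by simp [crT]

/-- what an admissible `(r, t)` means for the prefix multiset -/
theorem admRT_specQ (hw : WfQ M fam) {r t : ℕ} (h : admRT r t (aggOf M fam) fam = true) :
    3 ≤ t ∧ t ≤ ((famT fam).map (p1T r)).sum ∧ t ≤ ((famT fam).map (p2T r)).sum ∧
      t ≤ ((famT fam).map (fibT r t)).sum := by
  unfold admRT at h
  simp only [Bool.and_eq_true, decide_eq_true_eq] at h
  rw [P1Of_eqQ hw, P2Of_eqQ hw, fibL_eqQ hw] at h
  exact ⟨h.1.1.1, h.1.1.2, h.1.2, h.2⟩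

/-- what `clAnyQ` certifies -/
theorem clAnyQ_spec {B : Buds} {g0 mdk L : ℕ} (h : clAnyQ B g0 mdk L = true) :
    ∃ i b, B.get i = some b ∧ g0 + b * (tabGQ L).get i ≤ mdk := by
  unfold clAnyQ at h
  simp only [Bool.or_eq_true] at h
  have key : ∀ i (o : Option ℕ), beClQ g0 mdk L i o = true → ∃ b, o = some b ∧ g0 + b * (tabGQ L).get i ≤ mdk := by
    intro i o ho; cases o with
    | none => exact absurd ho (by simp [beClQ])
    | some b => exact ⟨b, rfl, by simpa [beClQ] using ho⟩
  rcases h with ((((h | h) | h) | h) | h) | h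
  · obtain ⟨b, hb, hle⟩ := key 0 _ h; exact ⟨0, b, hb, hle⟩
  · obtain ⟨b, hb, hle⟩ := key 1 _ h; exact ⟨1, b, hb, hle⟩
  · obtain ⟨b, hb, hle⟩ := key 2 _ h; exact ⟨2, b, hb, hle⟩
  · obtain ⟨b, hb, hle⟩ := key 3 _ h; exact ⟨3, b, hb, hle⟩
  · obtain ⟨b, hb, hle⟩ := key 4 _ h; exact ⟨4, b, hb, hle⟩
  · obtain ⟨b, hb, hle⟩ := key 5 _ h; exact ⟨5, b, hb, hle⟩

/-- the selection invariant of `gpickQ`: a found selection is one of the budgets -/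
theorem gpickQ_inv (L : ℕ) (B : Buds) {cur : GSel} (hcur : cur.ok = true → B.get cur.idx = some cur.bud) (i : ℕ) :
    (gpickQ L cur i (B.get i)).ok = true → B.get (gpickQ L cur i (B.get i)).idx = some (gpickQ L cur i (B.get i)).bud := by
  unfold gpickQ
  cases hB : B.get i with
  | none => simpa [hB] using hcur
  | some b =>
    simp only [seqN_eq]
    split_ifs with hc
    · exact hcur
    · intro _; exact hB

/-- the node's Grynkiewicz selection is one of the budgets -/
theorem gnodeQ_spec (L : ℕ) (B : Buds) (h : (gnodeQ L B).ok = true) : B.get (gnodeQ L B).idx = some (gnodeQ L B).bud := by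
  have e : gnodeQ L B = gpickQ L (gpickQ L (gpickQ L (gpickQ L (gpickQ L (gpickQ L ⟨false, 0, 0, 0⟩
      0 (B.get 0)) 1 (B.get 1)) 2 (B.get 2)) 3 (B.get 3)) 4 (B.get 4)) 5 (B.get 5) := rfl
  rw [e] at h ⊢
  refine gpickQ_inv L B (gpickQ_inv L B (gpickQ_inv L B (gpickQ_inv L B (gpickQ_inv L B (gpickQ_inv L B ?_ 0) 1) 2) 3) 4) 5 h
  intro h0; exact absurd h0 (by simp)

/-- the binary search keeps «`l = loLev` or `p (l − 1)`» -/
theorem bsearch_invQ (p : ℕ → Bool) : ∀ (n l h : ℕ), (l = loLev ∨ p (l - 1) = true) →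
    (bsearch p n l h = loLev ∨ p (bsearch p n l h - 1) = true)
  | 0, l, h, hl => by rw [bsearch]; exact hl
  | n + 1, l, h, hl => by
    rw [bsearch]
    by_cases h1 : h ≤ l
    · rw [if_pos h1]; exact hl
    · rw [if_neg h1]
      simp only
      by_cases h2 : p ((l + h) / 2) = true
      · rw [if_pos h2]; exact bsearch_invQ p n _ _ (Or.inr (by simpa using h2))
      · rw [if_neg h2]; exact bsearch_invQ p n _ _ hl

/-- what a break level certifies: at level `lb1 − 1 ≥ loLev` one of the two bounds closes -/
theorem breakLevQ_spec {g0 q : ℕ} {sel : B8 → ℕ} {mdk : ℕ} {gb : Bool} {gB gi lb1 : ℕ}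
    (h : breakLevQ g0 q sel mdk gb gB gi = lb1) (h0 : lb1 ≠ 0) :
    loLev ≤ lb1 - 1 ∧ (g0 + sel (tabRQ (lb1 - 1)) * q ≤ mdk ∨ (gb = true ∧ g0 + gB * (tabGQ (lb1 - 1)).get gi ≤ mdk)) := by
  unfold breakLevQ at h
  simp only [seqN_eq] at h
  set r := bsearch (fun L => decide (g0 + sel (tabRQ L) * q ≤ mdk)) 7 loLev hiLev with hr
  set g := (if gb then bsearch (fun L => decide (g0 + gB * (tabGQ L).get gi ≤ mdk)) 7 loLev hiLev else loLev) with hg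
  have hR := bsearch_invQ (fun L => decide (g0 + sel (tabRQ L) * q ≤ mdk)) 7 loLev hiLev (Or.inl rfl)
  rw [← hr] at hR
  by_cases hm : max r g ≤ loLev
  · rw [if_pos hm] at h; exact absurd h.symm h0
  · rw [if_neg hm] at h
    rw [← h]
    rcases le_total g r with hgr | hgr
    · rw [max_eq_left hgr] at hm ⊢
      refine ⟨by omega, Or.inl ?_⟩
      rcases hR with hR | hR
      · omega
      · simpa using hR
    · rw [max_eq_right hgr] at hm ⊢
      refine ⟨by omega, Or.inr ?_⟩
      cases gb with
      | false => simp only [Bool.false_eq_true, ↓reduceIte] at hg; omega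
      | true =>
        simp only [↓reduceIte] at hg
        have hG := bsearch_invQ (fun L => decide (g0 + gB * (tabGQ L).get gi ≤ mdk)) 7 loLev hiLev (Or.inl rfl)
        rw [← hg] at hG
        rcases hG with hG | hG
        · omega
        · exact ⟨rfl, by simpa using hG⟩

end translation

end Summit.MatrixMultiplication.MatrixMultiplication.Theorems.ShapeCertVQ
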